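import Summits.HodgeConjecture.CorCM.Census.OcticTwistCoverShapes

/-!
# The octic twist `(ℤ/8 × B, (4,0))`, XI: THE COVERING FAMILY ON THE SLICES — exact quartic reductions and the mixed squares are available

COR-CM (cell `pub-hodgecm2`), count-neutral kernel combinatorics by the binder seat b09 (gen 33; lane COINVARIANT-TWIST / OCTIC RECON, the
equipment for design step 4 of `HOME/pub-hodgecm2-b09/lean-g33/COINVARIANT-TWIST.md` PART C), on top of parts I–X (`Census/OcticTwist*.lean`:
`spanMot`, `IsFace₂`, `potOrb`, `Covers₂`, **`exists_rel'`**) and the quartic files (`QuarticTwistReduction`: `Covers`, `HasColumnFaces`;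
`QuarticTwistCount`: `isRes_tw`, `tw_flip'`) BY NAME.  Theorems only; no certificate, no named fact, no `sorry`.
HONEST FRAMING: `HC_CM` is NOT proved; nothing here is a period or a headline.

WHY.  Part IVʼs covering family is chosen abstractly (`Covers₂` only), enough for the REDUCTION (part III).  The CLOSING step needs EXACT quartic
reductions on the slices `{v | v ⊗ e_{s₀} ∈ N}`, `{w | e_{s₀} ⊗ w ∈ N}` at a SMALL RESIDUAL passive coordinate `s₀` (a constant or a `±1`-atom),
i.e. `QuarticTwistReduction.single_sub_affine_mem` / `exists_reduced`, whose hypotheses are `Covers` and `HasColumnFaces` for the slice; and it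
needs the MIXED SQUARES `(e_a − e_u) ⊗ (e_{a′} − e_{u′})` at the `(±atom, ±atom)` types (with a reduced mixed closing face they give the D-moves).
**`exists_cover_family'`** (`|B| ≥ 3`): a finite family `S ⊆ IsFace₂`, `|S| ≤ #{blocks of potential ≥ 2}`, `Covers₂ (spanMot S)`, and
(i) for every small residual `s₀`: `Covers B ((spanMot S).comap (emb₀ s₀))`, `HasColumnFaces B (…)`, and the same for `emb₁ s₀` (a type `(s, s₀)`
is reached from its block representative by a diagonal motion — the representativeʼs face is then in the right coordinate — or by a swap-twist —
then it is in the other coordinate of a swapped representative, and the swap carries it over); (ii) every mixed square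
`(e_{u+kδ_b} − e_u) ⊗ (e_{u′+k′δ_{b′}} − e_{u′})` (`k, k′ = ±1`) lies in `spanMot S`.

## References
* [Pohlmann1968] H. Pohlmann, Algebraic cycles on abelian varieties of complex multiplication type, Ann. of Math. 88 (1968), Thm 1.
-/

namespace Summit.HodgeConjecture.CorCM.Census.OcticTwist

open Finset
open Summit.HodgeConjecture.CorCM.Census.QuarticTwist

variable (B : Type) [AddGroup B] [Fintype B] [DecidableEq B]

/-! ## The covering family with its slices and mixed squares -/

omit [Fintype B] [DecidableEq B] in
/-- Places keep different columns under `plc`. [folklore] -/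
theorem plc_snd_ne {h : ZMod 4 × B} {p q : ZMod 2 × B} (hpq : p.2 ≠ q.2) : (plc B h p).2 ≠ (plc B h q).2 := by
  unfold plc
  intro e
  exact hpq (sub_left_injective e)

/-- `plc` of the two places of a column `b` are the two places of the column `b − h.2`, in some order. [folklore] -/
theorem faceVec_plc_col (h : ZMod 4 × B) (s : Ty B) (b : B) :
    faceVec B s (plc B h ((0 : ZMod 2), b)) (plc B h ((1 : ZMod 2), b)) = faceVec B s ((0 : ZMod 2), b - h.2) ((1 : ZMod 2), b - h.2) := by
  unfold plc
  simp only [zero_add]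
  have key : ∀ v : ZMod 2, v = 0 ∨ v = 1 := by decide
  rcases key (par h.1) with hv | hv
  · rw [hv, show (1 : ZMod 2) + 0 = 1 by decide]
  · rw [hv, show (1 : ZMod 2) + 1 = 0 by decide, faceVec_col_comm]

omit [Fintype B] in
/-- A small residual type stays small residual under the inverse twist: from `tw h r = s₀`. [folklore] -/
theorem res_of_tw_eq {s₀ r : Ty B} (hres : IsRes B s₀) (h2a : ¬ ∃ (u : ZMod 4) (b : B), s₀ = atom B u b 2)
    (h : ZMod 4 × B) (hr : tw B h r = s₀) : IsRes B r ∧ ¬ ∃ (u : ZMod 4) (b : B), r = atom B u b 2 := by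
  have hR : r = tw B (-h) s₀ := by rw [← hr, tw_neg_tw]
  refine ⟨hR ▸ isRes_tw B hres (-h), ?_⟩
  rintro ⟨u, b, hu⟩
  apply h2a
  refine ⟨u + h.1, b - h.2, ?_⟩
  have := congrArg (tw B h) hu
  rw [hR, tw_tw_neg, tw_atom] at this
  exact this

/-- **THE COVERING FAMILY WITH ITS SLICES** (`|B| ≥ 3`): a finite family `S` of octic faces, at most one per block of potential `≥ 2`, whose
motions cover in the sense of `Covers₂`, AND such that every slice at a SMALL RESIDUAL passive coordinate `s₀` (a constant or a `±1`-atom) —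
`{v | v ⊗ e_{s₀} ∈ spanMot S}` and `{w | e_{s₀} ⊗ w ∈ spanMot S}` — COVERS in the quartic sense and has the column faces at the constant types
(so that the quartic affine reduction `QuarticTwistReduction.single_sub_affine_mem` / `exists_reduced` runs EXACTLY on these slices). [folklore] -/
theorem exists_cover_family' (h3 : 3 ≤ Fintype.card B) :
    ∃ S : Finset (Ty₂ B → ℤ), (∀ f ∈ S, IsFace₂ B f) ∧ S.card ≤ Fintype.card {ω : Orb₂ B // 2 ≤ potOrb B ω} ∧ Covers₂ B (spanMot B S) ∧
      (∀ s₀ : Ty B, IsRes B s₀ → (¬ ∃ (u : ZMod 4) (b : B), s₀ = atom B u b 2) →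
        Covers B ((spanMot B S).comap (emb₀ B s₀)) ∧ HasColumnFaces B ((spanMot B S).comap (emb₀ B s₀))) ∧
      (∀ s₀ : Ty B, IsRes B s₀ → (¬ ∃ (u : ZMod 4) (b : B), s₀ = atom B u b 2) →
        Covers B ((spanMot B S).comap (emb₁ B s₀)) ∧ HasColumnFaces B ((spanMot B S).comap (emb₁ B s₀))) ∧
      (∀ (u : ZMod 4) (b : B) (k : ZMod 4) (u' : ZMod 4) (b' : B) (k' : ZMod 4), (k = 1 ∨ k = -1) → (k' = 1 ∨ k' = -1) →
        tens B (Pi.single (atom B u b k) 1 - Pi.single (cst B u) 1) (Pi.single (atom B u' b' k') 1 - Pi.single (cst B u') 1) ∈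
          spanMot B S) := by
  classical
  haveI : Nonempty B := Fintype.card_pos_iff.mp (by omega)
  have hrep : ∀ ω : {ω : Orb₂ B // 2 ≤ potOrb B ω}, 2 ≤ pot B ω.1.out := by
    intro ω
    have h := ω.2
    rw [← Quotient.out_eq ω.1, potOrb_mk] at h
    exact h
  choose T₁ T₂ T₃ hF hP hc1 hc2 hc3 hc4 hc5 using fun ω : {ω : Orb₂ B // 2 ≤ potOrb B ω} => exists_rel' B h3 ω.1.out (hrep ω)
  let F : {ω : Orb₂ B // 2 ≤ potOrb B ω} → (Ty₂ B → ℤ) := fun ω =>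
    Pi.single ω.1.out 1 - Pi.single (T₁ ω) 1 - Pi.single (T₂ ω) 1 + Pi.single (T₃ ω) 1
  let S := Finset.univ.image F
  have hmemS : ∀ ω, ∀ (e : Bool) (h : ZMod 4 × B), transl₂ B e h (F ω) ∈ spanMot B S :=
    fun ω e h => transl₂_mem_spanMot_of_mem B (Finset.mem_image_of_mem F (Finset.mem_univ ω)) e h
  have hblock : ∀ T : Ty₂ B, 2 ≤ pot B T → ∃ (ω : {ω : Orb₂ B // 2 ≤ potOrb B ω}) (e : Bool) (h : ZMod 4 × B), act B e h ω.1.out = T := by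
    intro T hT
    let ω : {ω : Orb₂ B // 2 ≤ potOrb B ω} := ⟨Quotient.mk (orbitRel₂ B) T, by rw [potOrb_mk]; exact hT⟩
    have hrel : (orbitRel₂ B).r ω.1.out T := Quotient.exact (Quotient.out_eq _)
    obtain ⟨e, h, hmove⟩ := hrel
    exact ⟨ω, e, h, hmove⟩
  have hlee2 : lee 2 = 2 := rfl
  refine ⟨S, ?_, Finset.card_image_le.trans (by rw [Finset.card_univ]), ?_, fun s₀ hres h2a => ⟨?_, ?_⟩, fun s₀ hres h2a => ⟨?_, ?_⟩, ?_⟩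
  · intro f hf
    obtain ⟨ω, _, rfl⟩ := Finset.mem_image.mp hf
    exact hF ω
  · intro T hT
    obtain ⟨ω, e, h, hmove⟩ := hblock T hT
    have hpot : pot B ω.1.out = pot B T := by rw [← hmove, pot_act]
    refine ⟨act B e h (T₁ ω), act B e h (T₂ ω), act B e h (T₃ ω), ?_, ?_, ?_, ?_⟩
    · have hmem := hmemS ω e h
      rw [transl₂_rel, hmove] at hmem
      exact hmem
    · rw [pot_act, ← hpot]; exact (hP ω).1
    · rw [pot_act, ← hpot]; exact (hP ω).2.1
    · rw [pot_act, ← hpot]; exact (hP ω).2.2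
  · -- Covers for the slice `emb₀ s₀`
    intro s hs
    have hT : 2 ≤ pot B (s, s₀) := by rw [pot_mk]; have := two_le_Phi_of_not_isRes B h3 hs; omega
    obtain ⟨ω, e, h, hmove⟩ := hblock _ hT
    cases e
    · rw [act_false] at hmove
      have h1 : tw B h ω.1.out.1 = s := (Prod.ext_iff.mp hmove).1
      have h2 : tw B h ω.1.out.2 = s₀ := (Prod.ext_iff.mp hmove).2
      have hs' : ¬ IsRes B ω.1.out.1 := fun hres' => hs (h1 ▸ isRes_tw B hres' h)
      obtain ⟨p, q, hpq, hrel, hp, hq, hpq'⟩ := hc1 ω hs'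
      refine ⟨plc B h p, plc B h q, plc_snd_ne B hpq, ?_, ?_, ?_, ?_⟩
      · show tens B (faceVec B s (plc B h p) (plc B h q)) (Pi.single s₀ 1) ∈ spanMot B S
        have hmem := hmemS ω false h
        dsimp only [F] at hmem
        rw [hrel, transl₂_false_cface₀, h1, h2] at hmem
        exact hmem
      · rw [← h1, ← tw_flip', Phi_tw, Phi_tw]; exact hp
      · rw [← h1, ← tw_flip', Phi_tw, Phi_tw]; exact hq
      · rw [← h1, ← tw_flip', ← tw_flip', Phi_tw, Phi_tw]; exact hpq'
    · rw [act_true] at hmove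
      have h1 : tw B h (tw B (1, 0) ω.1.out.2) = s := (Prod.ext_iff.mp hmove).1
      have h2 : tw B h ω.1.out.1 = s₀ := (Prod.ext_iff.mp hmove).2
      obtain ⟨hres1, hn2⟩ := res_of_tw_eq B hres h2a h h2
      rw [tw_tw] at h1
      have ht' : ¬ IsRes B ω.1.out.2 := fun hres' => hs (h1 ▸ isRes_tw B hres' _)
      obtain ⟨p, q, hpq, hrel, hp, hq, hpq'⟩ := hc3 ω hres1 hn2 ht'
      refine ⟨plc B (h + (1, 0)) p, plc B (h + (1, 0)) q, plc_snd_ne B hpq, ?_, ?_, ?_, ?_⟩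
      · show tens B (faceVec B s (plc B (h + (1, 0)) p) (plc B (h + (1, 0)) q)) (Pi.single s₀ 1) ∈ spanMot B S
        have hmem := hmemS ω true h
        dsimp only [F] at hmem
        rw [hrel, transl₂_true_tens, transl_single, transl_faceVec, h1, h2] at hmem
        exact hmem
      · rw [← h1, ← tw_flip', Phi_tw, Phi_tw]; exact hp
      · rw [← h1, ← tw_flip', Phi_tw, Phi_tw]; exact hq
      · rw [← h1, ← tw_flip', ← tw_flip', Phi_tw, Phi_tw]; exact hpq'
  · -- HasColumnFaces for the slice `emb₀ s₀`
    intro u b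
    have hT : 2 ≤ pot B (atom B u b 2, s₀) := by rw [pot_mk, Phi_atom B h3, hlee2]; omega
    obtain ⟨ω, e, h, hmove⟩ := hblock _ hT
    cases e
    · rw [act_false] at hmove
      have h1 : tw B h ω.1.out.1 = atom B u b 2 := (Prod.ext_iff.mp hmove).1
      have h2 : tw B h ω.1.out.2 = s₀ := (Prod.ext_iff.mp hmove).2
      have ha : ω.1.out.1 = atom B (u - h.1) (b + h.2) 2 := by
        have := congrArg (tw B (-h)) h1
        rw [tw_neg_tw, tw_atom] at this
        rw [this, Prod.fst_neg, Prod.snd_neg, sub_neg_eq_add, ← sub_eq_add_neg]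
      have hrel := hc2 ω (u - h.1) (b + h.2) ha
      show tens B (faceVec B (cst B u) (0, b) (1, b)) (Pi.single s₀ 1) ∈ spanMot B S
      have hmem := hmemS ω false h
      dsimp only [F] at hmem
      rw [hrel, transl₂_false_cface₀, tw_cst, h2, faceVec_plc_col, add_sub_cancel_right, sub_add_cancel] at hmem
      exact hmem
    · rw [act_true] at hmove
      have h1 : tw B h (tw B (1, 0) ω.1.out.2) = atom B u b 2 := (Prod.ext_iff.mp hmove).1
      have h2 : tw B h ω.1.out.1 = s₀ := (Prod.ext_iff.mp hmove).2
      obtain ⟨hres1, hn2⟩ := res_of_tw_eq B hres h2a h h2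
      rw [tw_tw] at h1
      have ha : ω.1.out.2 = atom B (u - (h + (1, 0)).1) (b + (h + (1, 0)).2) 2 := by
        have := congrArg (tw B (-(h + (1, 0)))) h1
        rw [tw_neg_tw, tw_atom] at this
        rw [this, Prod.fst_neg, Prod.snd_neg, sub_neg_eq_add, ← sub_eq_add_neg]
      have hrel := hc4 ω hres1 hn2 _ _ ha
      show tens B (faceVec B (cst B u) (0, b) (1, b)) (Pi.single s₀ 1) ∈ spanMot B S
      have hmem := hmemS ω true h
      dsimp only [F] at hmem
      rw [hrel, transl₂_true_tens, transl_single, transl_faceVec, tw_cst, h2, faceVec_plc_col, add_sub_cancel_right, sub_add_cancel] at hmem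
      exact hmem
  · -- Covers for the slice `emb₁ s₀`
    intro t ht
    have hT : 2 ≤ pot B (s₀, t) := by rw [pot_mk]; have := two_le_Phi_of_not_isRes B h3 ht; omega
    obtain ⟨ω, e, h, hmove⟩ := hblock _ hT
    cases e
    · rw [act_false] at hmove
      have h1 : tw B h ω.1.out.1 = s₀ := (Prod.ext_iff.mp hmove).1
      have h2 : tw B h ω.1.out.2 = t := (Prod.ext_iff.mp hmove).2
      obtain ⟨hres1, hn2⟩ := res_of_tw_eq B hres h2a h h1
      have ht' : ¬ IsRes B ω.1.out.2 := fun hres' => ht (h2 ▸ isRes_tw B hres' h)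
      obtain ⟨p, q, hpq, hrel, hp, hq, hpq'⟩ := hc3 ω hres1 hn2 ht'
      refine ⟨plc B h p, plc B h q, plc_snd_ne B hpq, ?_, ?_, ?_, ?_⟩
      · show tens B (Pi.single s₀ 1) (faceVec B t (plc B h p) (plc B h q)) ∈ spanMot B S
        have hmem := hmemS ω false h
        dsimp only [F] at hmem
        rw [hrel, transl₂_false_tens, transl_single, transl_faceVec, h1, h2] at hmem
        exact hmem
      · rw [← h2, ← tw_flip', Phi_tw, Phi_tw]; exact hp
      · rw [← h2, ← tw_flip', Phi_tw, Phi_tw]; exact hq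
      · rw [← h2, ← tw_flip', ← tw_flip', Phi_tw, Phi_tw]; exact hpq'
    · rw [act_true] at hmove
      have h1 : tw B h (tw B (1, 0) ω.1.out.2) = s₀ := (Prod.ext_iff.mp hmove).1
      have h2 : tw B h ω.1.out.1 = t := (Prod.ext_iff.mp hmove).2
      have hs' : ¬ IsRes B ω.1.out.1 := fun hres' => ht (h2 ▸ isRes_tw B hres' h)
      obtain ⟨p, q, hpq, hrel, hp, hq, hpq'⟩ := hc1 ω hs'
      rw [tw_tw] at h1
      refine ⟨plc B h p, plc B h q, plc_snd_ne B hpq, ?_, ?_, ?_, ?_⟩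
      · show tens B (Pi.single s₀ 1) (faceVec B t (plc B h p) (plc B h q)) ∈ spanMot B S
        have hmem := hmemS ω true h
        dsimp only [F] at hmem
        rw [hrel, transl₂_true_cface₀, h1, h2] at hmem
        exact hmem
      · rw [← h2, ← tw_flip', Phi_tw, Phi_tw]; exact hp
      · rw [← h2, ← tw_flip', Phi_tw, Phi_tw]; exact hq
      · rw [← h2, ← tw_flip', ← tw_flip', Phi_tw, Phi_tw]; exact hpq'
  · -- HasColumnFaces for the slice `emb₁ s₀`
    intro u b
    have hT : 2 ≤ pot B (s₀, atom B u b 2) := by rw [pot_mk, Phi_atom B h3, hlee2]; omega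
    obtain ⟨ω, e, h, hmove⟩ := hblock _ hT
    cases e
    · rw [act_false] at hmove
      have h1 : tw B h ω.1.out.1 = s₀ := (Prod.ext_iff.mp hmove).1
      have h2 : tw B h ω.1.out.2 = atom B u b 2 := (Prod.ext_iff.mp hmove).2
      obtain ⟨hres1, hn2⟩ := res_of_tw_eq B hres h2a h h1
      have ha : ω.1.out.2 = atom B (u - h.1) (b + h.2) 2 := by
        have := congrArg (tw B (-h)) h2
        rw [tw_neg_tw, tw_atom] at this
        rw [this, Prod.fst_neg, Prod.snd_neg, sub_neg_eq_add, ← sub_eq_add_neg]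
      have hrel := hc4 ω hres1 hn2 _ _ ha
      show tens B (Pi.single s₀ 1) (faceVec B (cst B u) (0, b) (1, b)) ∈ spanMot B S
      have hmem := hmemS ω false h
      dsimp only [F] at hmem
      rw [hrel, transl₂_false_tens, transl_single, transl_faceVec, tw_cst, h1, faceVec_plc_col, add_sub_cancel_right, sub_add_cancel] at hmem
      exact hmem
    · rw [act_true] at hmove
      have h1 : tw B h (tw B (1, 0) ω.1.out.2) = s₀ := (Prod.ext_iff.mp hmove).1
      have h2 : tw B h ω.1.out.1 = atom B u b 2 := (Prod.ext_iff.mp hmove).2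
      have ha : ω.1.out.1 = atom B (u - h.1) (b + h.2) 2 := by
        have := congrArg (tw B (-h)) h2
        rw [tw_neg_tw, tw_atom] at this
        rw [this, Prod.fst_neg, Prod.snd_neg, sub_neg_eq_add, ← sub_eq_add_neg]
      have hrel := hc2 ω _ _ ha
      rw [tw_tw] at h1
      show tens B (Pi.single s₀ 1) (faceVec B (cst B u) (0, b) (1, b)) ∈ spanMot B S
      have hmem := hmemS ω true h
      dsimp only [F] at hmem
      rw [hrel, transl₂_true_cface₀, tw_cst, h1, faceVec_plc_col, add_sub_cancel_right, sub_add_cancel] at hmem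
      exact hmem
  · -- the mixed squares at the `(±atom, ±atom)` types
    intro u b k u' b' k' hk hk'
    have hT : 2 ≤ pot B (atom B u b k, atom B u' b' k') := by
      rw [pot_mk, Phi_atom B h3, Phi_atom B h3, (lee_eq_one_iff k).mpr hk, (lee_eq_one_iff k').mpr hk']
    obtain ⟨ω, e, h, hmove⟩ := hblock _ hT
    cases e
    · rw [act_false] at hmove
      have h1 : tw B h ω.1.out.1 = atom B u b k := (Prod.ext_iff.mp hmove).1
      have h2 : tw B h ω.1.out.2 = atom B u' b' k' := (Prod.ext_iff.mp hmove).2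
      have ha : ω.1.out.1 = atom B (u - h.1) (b + h.2) k := by
        have := congrArg (tw B (-h)) h1
        rw [tw_neg_tw, tw_atom] at this
        rw [this, Prod.fst_neg, Prod.snd_neg, sub_neg_eq_add, ← sub_eq_add_neg]
      have ha' : ω.1.out.2 = atom B (u' - h.1) (b' + h.2) k' := by
        have := congrArg (tw B (-h)) h2
        rw [tw_neg_tw, tw_atom] at this
        rw [this, Prod.fst_neg, Prod.snd_neg, sub_neg_eq_add, ← sub_eq_add_neg]
      have hrel := hc5 ω _ _ _ _ _ _ (Prod.ext ha ha') hk hk'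
      have hmem := hmemS ω false h
      dsimp only [F] at hmem
      rw [hrel, transl₂_false_tens, transl_sub, transl_sub, transl_single, transl_single, transl_single, transl_single, tw_atom, tw_atom,
        tw_cst, tw_cst, sub_add_cancel, sub_add_cancel, add_sub_cancel_right, add_sub_cancel_right] at hmem
      exact hmem
    · rw [act_true] at hmove
      have h1 : tw B h (tw B (1, 0) ω.1.out.2) = atom B u b k := (Prod.ext_iff.mp hmove).1
      have h2 : tw B h ω.1.out.1 = atom B u' b' k' := (Prod.ext_iff.mp hmove).2
      rw [tw_tw] at h1
      have ha : ω.1.out.1 = atom B (u' - h.1) (b' + h.2) k' := by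
        have := congrArg (tw B (-h)) h2
        rw [tw_neg_tw, tw_atom] at this
        rw [this, Prod.fst_neg, Prod.snd_neg, sub_neg_eq_add, ← sub_eq_add_neg]
      have ha' : ω.1.out.2 = atom B (u - (h + (1, 0)).1) (b + (h + (1, 0)).2) k := by
        have := congrArg (tw B (-(h + (1, 0)))) h1
        rw [tw_neg_tw, tw_atom] at this
        rw [this, Prod.fst_neg, Prod.snd_neg, sub_neg_eq_add, ← sub_eq_add_neg]
      have hrel := hc5 ω _ _ _ _ _ _ (Prod.ext ha ha') hk' hk
      have hmem := hmemS ω true h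
      dsimp only [F] at hmem
      rw [hrel, transl₂_true_tens, transl_sub, transl_sub, transl_single, transl_single, transl_single, transl_single, tw_atom, tw_atom,
        tw_cst, tw_cst, sub_add_cancel, sub_add_cancel, add_sub_cancel_right, add_sub_cancel_right] at hmem
      exact hmem

end Summit.HodgeConjecture.CorCM.Census.OcticTwist
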